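import Summits.Parity.GeneralizedHardyLittlewood.Theorems.DilatedTableChowla.Negative.DilatedTableChowlaOffDiagonal

/-!
# `DilatedTableChowla` (stmt-Parity-14271): a pointwise bound off a harmonically sparse set of dilations suffices — and is necessary: `crux ↔ PointwiseOffSparse`; which exceptional moduli are affordable

Negative lemmas for the crux `LiouvilleShiftedTables.DilatedTableChowla` (route LiouvilleShiftedTables, X1; cdisprove seat), landed verbatim from the crux work file `Cruxes/DilatedTableChowla/Disproof.lean` (§10, §11b, §14 there) so that skeletons, ideators and provers can import them.  Notation (`rows`, `cols`, `S`, `F`, `lhs`, `crux_iff_lhs`) from `DilatedTableChowlaBlocks`. [folklore]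
-/

namespace Summit.Parity.GeneralizedHardyLittlewood.Theorems.DilatedTableChowla.Negative

open Summit.Parity.GeneralizedHardyLittlewood.Theses.LiouvilleShiftedTables
open Finset

/-! ## §10 (h) DIVISION OF LABOUR: a pointwise bound OUTSIDE a sparse exceptional set of dilations suffices

`PointwiseOffExceptional`: for all large `x`, every window scale `A` and all classes there is an
exceptional set `E` of dilations with `Σ_{q∈E} 1/q ≤ (log x)^{-C}/200` such that for every other
dilation `q ≤ x^{δ/2}` the POINTWISE bound `q⁴ · Foff(q,u q,v q) ≤ x²/(log x)^{C+2}` holds (a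
`(log x)^{C+2}` saving over the trivial `x²/q⁴`, off-diagonal only). This implies the crux
(`crux_of_pointwiseOffExceptional`): on `E` the trivial bound costs `36 x² Σ_{q∈E} 1/q`, the generic
dilations cost `(1 + log x^{δ/2}) x²/(log x)^{C+2} ≤ x²/(log x)^{C+1}`, the diagonal `12x²/x^{δ/2}`.
`E` may depend on `x, A` and the classes. This is exactly the room a Siegel-exceptional modulus
`q₁` needs: its multiples `q₁ m ≤ x^{δ/2}` have `Σ 1/q ≤ (1 + log x)/q₁`, affordable iff
`q₁ ≫ (log x)^{C+1}`; smaller exceptional conductors must be beaten INSIDE the pointwise bound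
(Siegel's theorem, ineffectively — allowed, since only `∃ x₀` is asked). -/

/-- Pointwise fourth-moment bound outside a harmonically-sparse exceptional set of dilations. -/
def PointwiseOffExceptional : Prop :=
  ∀ c : ℤ, c ≠ 0 → ∀ δ : ℝ, 0 < δ → δ ≤ 1 / 12 → ∀ C : ℝ, 0 < C → ∃ x₀ : ℝ, ∀ x : ℝ, x₀ ≤ x →
    ∀ A : ℝ, x ^ δ ≤ A → A ≤ x ^ (1 / 3 + δ) → ∀ u v : ℕ → ℕ,
      ∃ E : Finset ℕ, (∑ q ∈ E, ((q : ℝ))⁻¹) ≤ (Real.log x ^ C)⁻¹ / 200 ∧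
        ∀ q : ℕ, 1 ≤ q → q ≤ ⌊x ^ (δ / 2)⌋₊ → q ∉ E →
          (q : ℝ) ^ 4 * Foff c x A q (u q) (v q) ≤ x ^ 2 / Real.log x ^ (C + 2)

/-- `Σ_{q ≤ Q} 1/q ≤ 1 + log Q`. -/
theorem harmonic_Icc_le (Q : ℕ) :
    ∑ q ∈ Finset.Icc 1 Q, ((q : ℝ))⁻¹ ≤ 1 + Real.log Q := by
  have h := harmonic_le_one_add_log Q
  have e : ((harmonic Q : ℚ) : ℝ) = ∑ q ∈ Finset.Icc 1 Q, ((q : ℝ))⁻¹ := by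
    rw [harmonic_eq_sum_Icc]; push_cast; rfl
  linarith [e.symm.le, e.le]

/-- `4 ≤ log x` for `x ≥ 64`. -/
theorem four_le_log_of_ge {x : ℝ} (hx : 64 ≤ x) : 4 ≤ Real.log x := by
  have h2 := Real.log_two_gt_d9
  calc (4 : ℝ) ≤ 6 * Real.log 2 := by linarith
    _ = Real.log ((2 : ℝ) ^ 6) := by rw [Real.log_pow]; norm_num
    _ ≤ Real.log x := Real.log_le_log (by norm_num) (by norm_num; linarith)

/-- (h) Sufficiency of the pointwise-outside-`E` bound. -/
theorem crux_of_pointwiseOffExceptional (h : PointwiseOffExceptional) : DilatedTableChowla := by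
  rw [crux_iff_lhs]
  intro c hc δ hδ hδ' C hC
  obtain ⟨x₁, hx₁⟩ := h c hc δ hδ hδ' C hC
  obtain ⟨x₂, hx₂⟩ := eventually_log_rpow_le 48 C (half_pos hδ)
  refine ⟨max (max x₁ x₂) 64, fun x hx A hA1 hA2 u v => ?_⟩
  have hx1 : x₁ ≤ x := le_trans (le_trans (le_max_left _ _) (le_max_left _ _)) hx
  have hx2 : x₂ ≤ x := le_trans (le_trans (le_max_right _ _) (le_max_left _ _)) hx
  have hx64 : 64 ≤ x := le_trans (le_max_right _ _) hx
  have hx1' : 1 ≤ x := by linarith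
  have hxpos : 0 < x := by linarith
  have hlog4 : 4 ≤ Real.log x := four_le_log_of_ge hx64
  have hlogpos : 0 < Real.log x := by linarith
  have hL : 0 < Real.log x ^ C := Real.rpow_pos_of_pos hlogpos C
  have hxd2 : 0 < x ^ (δ / 2) := Real.rpow_pos_of_pos hxpos _
  obtain ⟨E, hE, hpt⟩ := hx₁ x hx1 A hA1 hA2 u v
  rw [lhs_eq_diag_add_off]
  -- (1) the diagonal
  have hd : lhsDiag c δ x A u v ≤ x ^ 2 / (4 * Real.log x ^ C) := by
    refine (lhsDiag_le (c := c) hδ hδ' hx1' hA1 hA2 u v).trans ?_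
    rw [div_le_div_iff₀ hxd2 (by positivity)]
    have : 12 * x ^ 2 * (4 * Real.log x ^ C) = x ^ 2 * (48 * Real.log x ^ C) := by ring
    rw [this]; gcongr; exact hx₂ x hx2
  -- (2) split the off-diagonal functional at E
  set Q : ℕ := ⌊x ^ (δ / 2)⌋₊ with hQdef
  have hQ1 : 1 ≤ Q := Nat.le_floor (by simpa using Real.one_le_rpow hx1' (by linarith : 0 ≤ δ / 2))
  have hsplit := Finset.sum_filter_add_sum_filter_not (Finset.Icc 1 Q) (fun q => q ∈ E)
    (fun q => (q : ℝ) ^ 3 * Foff c x A q (u q) (v q))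
  -- (2a) exceptional dilations: trivial bound `q³ F ≤ 36 x²/q`
  have hexc : ∑ q ∈ (Finset.Icc 1 Q).filter (fun q => q ∈ E), (q : ℝ) ^ 3 * Foff c x A q (u q) (v q)
      ≤ 36 * x ^ 2 * ∑ q ∈ E, ((q : ℝ))⁻¹ := by
    calc ∑ q ∈ (Finset.Icc 1 Q).filter (fun q => q ∈ E), (q : ℝ) ^ 3 * Foff c x A q (u q) (v q)
        ≤ ∑ q ∈ (Finset.Icc 1 Q).filter (fun q => q ∈ E), 36 * x ^ 2 * ((q : ℝ))⁻¹ := by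
          refine Finset.sum_le_sum fun q hq => ?_
          obtain ⟨hq, -⟩ := Finset.mem_filter.1 hq
          obtain ⟨hq1, hq2⟩ := Finset.mem_Icc.1 hq
          have hqpos : (0 : ℝ) < q := by exact_mod_cast hq1
          obtain ⟨hr, hcl, -, -, -, h1A⟩ := window_counts hδ hδ' hx1' hA1 hA2 hq1 hq2 (u q) (v q)
          have hApos : 0 < A := by linarith
          have hF := (Foff_le_F c x A q (u q) (v q)).trans (F_le_trivial c x A q (u q) (v q))
          calc (q : ℝ) ^ 3 * Foff c x A q (u q) (v q)
              ≤ (q : ℝ) ^ 3 * ((3 * A / q) ^ 2 * (2 * x / (A * q)) ^ 2) := by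
                gcongr
                exact hF.trans (by gcongr)
            _ = 36 * x ^ 2 * ((q : ℝ))⁻¹ := by field_simp; ring
      _ ≤ ∑ q ∈ E, 36 * x ^ 2 * ((q : ℝ))⁻¹ :=
          Finset.sum_le_sum_of_subset_of_nonneg (fun q hq => (Finset.mem_filter.1 hq).2)
            fun q _ _ => by positivity
      _ = 36 * x ^ 2 * ∑ q ∈ E, ((q : ℝ))⁻¹ := by rw [Finset.mul_sum]
  -- (2b) generic dilations: the pointwise hypothesis and the harmonic sum
  have hgen : ∑ q ∈ (Finset.Icc 1 Q).filter (fun q => ¬ q ∈ E), (q : ℝ) ^ 3 * Foff c x A q (u q) (v q)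
      ≤ (1 + Real.log Q) * (x ^ 2 / Real.log x ^ (C + 2)) := by
    calc ∑ q ∈ (Finset.Icc 1 Q).filter (fun q => ¬ q ∈ E), (q : ℝ) ^ 3 * Foff c x A q (u q) (v q)
        ≤ ∑ q ∈ (Finset.Icc 1 Q).filter (fun q => ¬ q ∈ E), ((q : ℝ))⁻¹ * (x ^ 2 / Real.log x ^ (C + 2)) := by
          refine Finset.sum_le_sum fun q hq => ?_
          obtain ⟨hq, hqE⟩ := Finset.mem_filter.1 hq
          obtain ⟨hq1, hq2⟩ := Finset.mem_Icc.1 hq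
          have hqpos : (0 : ℝ) < q := by exact_mod_cast hq1
          have hp := hpt q hq1 hq2 hqE
          calc (q : ℝ) ^ 3 * Foff c x A q (u q) (v q)
              = ((q : ℝ))⁻¹ * ((q : ℝ) ^ 4 * Foff c x A q (u q) (v q)) := by field_simp
            _ ≤ ((q : ℝ))⁻¹ * (x ^ 2 / Real.log x ^ (C + 2)) := by gcongr
      _ ≤ ∑ q ∈ Finset.Icc 1 Q, ((q : ℝ))⁻¹ * (x ^ 2 / Real.log x ^ (C + 2)) :=
          Finset.sum_le_sum_of_subset_of_nonneg (Finset.filter_subset _ _) fun q _ _ => by positivity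
      _ = (∑ q ∈ Finset.Icc 1 Q, ((q : ℝ))⁻¹) * (x ^ 2 / Real.log x ^ (C + 2)) := by rw [Finset.sum_mul]
      _ ≤ (1 + Real.log Q) * (x ^ 2 / Real.log x ^ (C + 2)) := by
          gcongr; exact harmonic_Icc_le Q
  -- (3) numerics: 1 + log Q ≤ log x, (log x)^{C+2} = (log x)^C (log x)², log x ≥ 4
  have hQpos : (0 : ℝ) < Q := by exact_mod_cast hQ1
  have hlogQ : Real.log Q ≤ δ / 2 * Real.log x := by
    have hQle : (Q : ℝ) ≤ x ^ (δ / 2) := Nat.floor_le hxd2.le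
    calc Real.log Q ≤ Real.log (x ^ (δ / 2)) := Real.log_le_log hQpos hQle
      _ = δ / 2 * Real.log x := Real.log_rpow hxpos _
  have h1logQ : 1 + Real.log Q ≤ Real.log x := by nlinarith
  have hpow : Real.log x ^ (C + 2) = Real.log x ^ C * Real.log x ^ 2 := by
    rw [Real.rpow_add hlogpos, Real.rpow_two]
  have hgen' : (1 + Real.log Q) * (x ^ 2 / Real.log x ^ (C + 2)) ≤ x ^ 2 / (4 * Real.log x ^ C) := by
    rw [hpow]
    calc (1 + Real.log Q) * (x ^ 2 / (Real.log x ^ C * Real.log x ^ 2))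
        ≤ Real.log x * (x ^ 2 / (Real.log x ^ C * Real.log x ^ 2)) := by gcongr
      _ = x ^ 2 / (Real.log x ^ C * Real.log x) := by field_simp
      _ ≤ x ^ 2 / (4 * Real.log x ^ C) := by
          apply div_le_div_of_nonneg_left (by positivity) (by positivity)
          nlinarith
  have hexc' : 36 * x ^ 2 * ∑ q ∈ E, ((q : ℝ))⁻¹ ≤ x ^ 2 / (4 * Real.log x ^ C) := by
    calc 36 * x ^ 2 * ∑ q ∈ E, ((q : ℝ))⁻¹ ≤ 36 * x ^ 2 * ((Real.log x ^ C)⁻¹ / 200) := by gcongr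
      _ ≤ x ^ 2 / (4 * Real.log x ^ C) := by
          rw [div_eq_mul_inv (x ^ 2), mul_inv]
          nlinarith [inv_pos.2 hL, sq_nonneg x]
  have hoff : lhsOff c δ x A u v ≤ x ^ 2 / (4 * Real.log x ^ C) + x ^ 2 / (4 * Real.log x ^ C) := by
    unfold lhsOff
    rw [← hQdef, ← hsplit]
    linarith [hexc, hgen, hgen', hexc']
  have : x ^ 2 / (4 * Real.log x ^ C) + x ^ 2 / (4 * Real.log x ^ C) + x ^ 2 / (4 * Real.log x ^ C)
      ≤ x ^ 2 / Real.log x ^ C := by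
    rw [← add_div, ← add_div, div_le_div_iff₀ (by positivity) hL]
    nlinarith [sq_nonneg x, hL]
  linarith



/-! ## §11b (k'') EXACT EQUIVALENCE: the crux IS the pointwise-off-sparse statement

`PointwiseOffSparse` — the shape of the skeleton stub (C⁺) of `Lines/positivity-quarantine.lean`
with its one-point hypothesis dropped: for all large `x`, all `A`, `u`, `v` there is a set `E'` of
dilations with `Σ_{q∈E'} 1/q ≤ (log x)^{-C}` such that `q⁴ F(q,u q,v q) ≤ x²/(log x)^C` for every
other `q ≤ x^{δ/2}`.  Because both statements ask `∀ C`, the log-power losses of §10 (sufficiency at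
`C+2` with mass `(log x)^{-C}/200`) and §11 (Markov) are absorbed:
`crux_iff_pointwiseOffSparse : DilatedTableChowla ↔ PointwiseOffSparse`. -/

/-- The pointwise block bound off a harmonically sparse exceptional set of dilations (the (C⁺) stub
of the skeleton `positivity-quarantine` WITHOUT its one-point hypothesis). -/
def PointwiseOffSparse : Prop :=
  ∀ c : ℤ, c ≠ 0 → ∀ δ : ℝ, 0 < δ → δ ≤ 1 / 12 → ∀ C : ℝ, 0 < C →
    ∃ x₀ : ℝ, ∀ x : ℝ, x₀ ≤ x → ∀ A : ℝ, x ^ δ ≤ A → A ≤ x ^ (1 / 3 + δ) → ∀ u v : ℕ → ℕ,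
      ∃ E' : Finset ℕ, (∑ q ∈ E', ((q : ℝ))⁻¹) ≤ (Real.log x ^ C)⁻¹ ∧
        ∀ q : ℕ, 1 ≤ q → q ≤ ⌊x ^ (δ / 2)⌋₊ → q ∉ E' →
          (q : ℝ) ^ 4 * F c x A q (u q) (v q) ≤ x ^ 2 / Real.log x ^ C

/-- (k'') The crux implies the pointwise-off-sparse statement (Markov, §11, at exponent `2C` with
threshold `K = (log x)^C`). -/
theorem crux_imp_pointwiseOffSparse (h : DilatedTableChowla) : PointwiseOffSparse := by
  intro c hc δ hδ hδ' C hC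
  obtain ⟨x₀, hx₀⟩ := crux_imp_pointwise_markov h c hc δ hδ hδ' (C + C) (by positivity)
  refine ⟨max x₀ 3, fun x hx A hA1 hA2 u v => ?_⟩
  have hx0 : x₀ ≤ x := le_trans (le_max_left _ _) hx
  have hx3 : (3 : ℝ) ≤ x := le_trans (le_max_right _ _) hx
  have hlog : 0 < Real.log x := Real.log_pos (by linarith)
  have hLC : 0 < Real.log x ^ C := Real.rpow_pos_of_pos hlog C
  have hmass := hx₀ x hx0 A hA1 hA2 u v (Real.log x ^ C) hLC
  refine ⟨(Finset.Icc 1 ⌊x ^ (δ / 2)⌋₊).filter (fun q : ℕ =>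
      Real.log x ^ C * (x ^ 2 / Real.log x ^ (C + C)) < (q : ℝ) ^ 4 * F c x A q (u q) (v q)),
    hmass, fun q hq1 hq2 hqE => ?_⟩
  have hle : (q : ℝ) ^ 4 * F c x A q (u q) (v q) ≤
      Real.log x ^ C * (x ^ 2 / Real.log x ^ (C + C)) := by
    by_contra hlt
    exact hqE (Finset.mem_filter.2 ⟨Finset.mem_Icc.2 ⟨hq1, hq2⟩, lt_of_not_ge hlt⟩)
  have heq : Real.log x ^ C * (x ^ 2 / Real.log x ^ (C + C)) = x ^ 2 / Real.log x ^ C := by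
    rw [Real.rpow_add hlog C C]
    field_simp
  exact hle.trans_eq heq

/-- (k'') Conversely the pointwise-off-sparse statement implies the crux (§10 at exponent `C`, fed
by `PointwiseOffSparse` at exponent `C + 3`: `(log x)^{-3} ≤ 1/200` once `log x ≥ 6`). -/
theorem pointwiseOffSparse_imp_crux (h : PointwiseOffSparse) : DilatedTableChowla := by
  apply crux_of_pointwiseOffExceptional
  intro c hc δ hδ hδ' C hC
  obtain ⟨x₀, hx₀⟩ := h c hc δ hδ hδ' (C + 3) (by linarith)
  refine ⟨max x₀ (Real.exp 6), fun x hx A hA1 hA2 u v => ?_⟩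
  have hx0 : x₀ ≤ x := le_trans (le_max_left _ _) hx
  have hxe : Real.exp 6 ≤ x := le_trans (le_max_right _ _) hx
  have hxpos : 0 < x := lt_of_lt_of_le (Real.exp_pos 6) hxe
  have hlog6 : 6 ≤ Real.log x := by rwa [Real.le_log_iff_exp_le hxpos]
  have hlogpos : 0 < Real.log x := by linarith
  obtain ⟨E, hE, hpt⟩ := hx₀ x hx0 A hA1 hA2 u v
  refine ⟨E, ?_, fun q hq1 hq2 hqE => ?_⟩
  · have hsplit : Real.log x ^ (C + 3) = Real.log x ^ C * Real.log x ^ (3 : ℝ) :=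
      Real.rpow_add hlogpos C 3
    have h3 : (200 : ℝ) ≤ Real.log x ^ (3 : ℝ) := by
      rw [show (3 : ℝ) = ((3 : ℕ) : ℝ) by norm_num, Real.rpow_natCast]
      have h63 : (6 : ℝ) ^ 3 ≤ Real.log x ^ 3 := pow_le_pow_left₀ (by norm_num) hlog6 3
      nlinarith [h63]
    have hLC : 0 < Real.log x ^ C := Real.rpow_pos_of_pos hlogpos C
    calc ∑ q ∈ E, ((q : ℝ))⁻¹ ≤ (Real.log x ^ (C + 3))⁻¹ := hE
      _ = (Real.log x ^ C)⁻¹ * (Real.log x ^ (3 : ℝ))⁻¹ := by rw [hsplit, mul_inv]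
      _ ≤ (Real.log x ^ C)⁻¹ * (200 : ℝ)⁻¹ :=
          mul_le_mul_of_nonneg_left (inv_anti₀ (by norm_num) h3) (inv_pos.2 hLC).le
      _ = (Real.log x ^ C)⁻¹ / 200 := by rw [div_eq_mul_inv]
  · have hp := hpt q hq1 hq2 hqE
    have hF : (q : ℝ) ^ 4 * Foff c x A q (u q) (v q) ≤ (q : ℝ) ^ 4 * F c x A q (u q) (v q) := by
      gcongr
      exact Foff_le_F c x A q (u q) (v q)
    have hmono : x ^ 2 / Real.log x ^ (C + 3) ≤ x ^ 2 / Real.log x ^ (C + 2) := by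
      apply div_le_div_of_nonneg_left (by positivity) (Real.rpow_pos_of_pos hlogpos _)
      exact Real.rpow_le_rpow_of_exponent_le (by linarith) (by linarith)
    exact hF.trans (hp.trans hmono)

/-- (k'') **`DilatedTableChowla ↔ PointwiseOffSparse`**: the `ℓ¹`-over-dilations crux IS the
statement "pointwise block bound `q⁴F ≤ x²/(log x)^C` off a prover-chosen exceptional set of
dilations of harmonic mass `≤ (log x)^{-C}`" — exactly, not only up to powers of `log x`. -/
theorem crux_iff_pointwiseOffSparse : DilatedTableChowla ↔ PointwiseOffSparse :=
  ⟨crux_imp_pointwiseOffSparse, pointwiseOffSparse_imp_crux⟩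


/-! ## §14 (h') Which exceptional moduli are affordable: multiples of `q₁` have harmonic mass `≤ (1+log Q)/q₁`

So in §10 one may take `E = {q ≤ x^{δ/2} : q₁ ∣ q}` for any single modulus
`q₁ ≥ 200 (1 + log x) (log x)^C` (`multiples_admissible`) — e.g. a Siegel-exceptional conductor beyond
`(log x)^{C+1+ε}`; exceptional conductors below that must be handled inside the pointwise bound. -/

/-- Harmonic mass of the multiples of `q₁` up to `Q`. -/
theorem sum_inv_multiples_le {q₁ : ℕ} (hq₁ : 1 ≤ q₁) (Q : ℕ) :
    ∑ q ∈ (Finset.Icc 1 Q).filter (fun q => q₁ ∣ q), ((q : ℝ))⁻¹ ≤ (1 + Real.log Q) / q₁ := by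
  have hq₁pos : (0 : ℝ) < q₁ := by exact_mod_cast hq₁
  -- the multiples of q₁ in [1, Q] are the image of [1, Q/q₁] under (· * q₁)
  have hsub : (Finset.Icc 1 Q).filter (fun q => q₁ ∣ q) ⊆
      (Finset.Icc 1 (Q / q₁)).image (fun k => k * q₁) := by
    intro q hq
    obtain ⟨hq, ⟨k, rfl⟩⟩ := Finset.mem_filter.1 hq
    obtain ⟨h1, h2⟩ := Finset.mem_Icc.1 hq
    refine Finset.mem_image.2 ⟨k, Finset.mem_Icc.2 ⟨?_, ?_⟩, by ring⟩
    · rcases Nat.eq_zero_or_pos k with hk | hk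
      · subst hk; simp at h1
      · exact hk
    · exact (Nat.le_div_iff_mul_le (by omega)).2 (by simpa [mul_comm] using h2)
  have hinj : Set.InjOn (fun k : ℕ => k * q₁) (Finset.Icc 1 (Q / q₁) : Set ℕ) :=
    fun a _ b _ hab => Nat.eq_of_mul_eq_mul_right (by omega) hab
  calc ∑ q ∈ (Finset.Icc 1 Q).filter (fun q => q₁ ∣ q), ((q : ℝ))⁻¹
      ≤ ∑ q ∈ (Finset.Icc 1 (Q / q₁)).image (fun k => k * q₁), ((q : ℝ))⁻¹ :=
        Finset.sum_le_sum_of_subset_of_nonneg hsub fun q _ _ => by positivity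
    _ = ∑ k ∈ Finset.Icc 1 (Q / q₁), (((k * q₁ : ℕ) : ℝ))⁻¹ := Finset.sum_image hinj
    _ = (∑ k ∈ Finset.Icc 1 (Q / q₁), ((k : ℝ))⁻¹) / q₁ := by
        rw [Finset.sum_div]
        refine Finset.sum_congr rfl fun k _ => ?_
        push_cast
        rw [mul_inv, div_eq_mul_inv]
    _ ≤ (1 + Real.log ((Q / q₁ : ℕ) : ℝ)) / q₁ := by
        gcongr; exact harmonic_Icc_le (Q / q₁)
    _ ≤ (1 + Real.log Q) / q₁ := by
        apply div_le_div_of_nonneg_right _ hq₁pos.le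
        have : Real.log ((Q / q₁ : ℕ) : ℝ) ≤ Real.log Q := by
          rcases Nat.eq_zero_or_pos (Q / q₁) with h0 | hpos
          · rw [h0, Nat.cast_zero, Real.log_zero]; exact Real.log_natCast_nonneg Q
          · exact Real.log_le_log (by exact_mod_cast hpos) (by exact_mod_cast Nat.div_le_self Q q₁)
        linarith

/-- (h') A single large modulus is affordable: its multiples satisfy the §10 condition. -/
theorem multiples_admissible {x : ℝ} (hx : 1 < x) {C δ : ℝ} (hδ2 : δ ≤ 2) {q₁ : ℕ}
    (hq₁ : 1 ≤ q₁) (hbig : 200 * (1 + Real.log x) * Real.log x ^ C ≤ q₁) :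
    ∑ q ∈ (Finset.Icc 1 ⌊x ^ (δ / 2)⌋₊).filter (fun q => q₁ ∣ q), ((q : ℝ))⁻¹
      ≤ (Real.log x ^ C)⁻¹ / 200 := by
  have hlog : 0 < Real.log x := Real.log_pos hx
  have hL : 0 < Real.log x ^ C := Real.rpow_pos_of_pos hlog C
  have hq₁pos : (0 : ℝ) < q₁ := by exact_mod_cast hq₁
  set Q : ℕ := ⌊x ^ (δ / 2)⌋₊ with hQ
  have hQx : (Q : ℝ) ≤ x := by
    calc (Q : ℝ) ≤ x ^ (δ / 2) := Nat.floor_le (Real.rpow_nonneg (by linarith) _)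
      _ ≤ x ^ (1 : ℝ) := Real.rpow_le_rpow_of_exponent_le hx.le (by linarith)
      _ = x := Real.rpow_one x
  have hlogQ : Real.log Q ≤ Real.log x := by
    rcases Nat.eq_zero_or_pos Q with h0 | hpos
    · rw [h0]; simp; exact hlog.le
    · exact Real.log_le_log (by exact_mod_cast hpos) hQx
  calc ∑ q ∈ (Finset.Icc 1 Q).filter (fun q => q₁ ∣ q), ((q : ℝ))⁻¹
      ≤ (1 + Real.log Q) / q₁ := sum_inv_multiples_le hq₁ Q
    _ ≤ (1 + Real.log x) / q₁ := by gcongr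
    _ ≤ (1 + Real.log x) / (200 * (1 + Real.log x) * Real.log x ^ C) :=
        div_le_div_of_nonneg_left (by linarith) (by positivity) hbig
    _ = (Real.log x ^ C)⁻¹ / 200 := by field_simp

end Summit.Parity.GeneralizedHardyLittlewood.Theorems.DilatedTableChowla.Negative
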